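import Literature.Geometry.Manifold.DirectLimitManifold
import Mathlib.Geometry.Manifold.SmoothEmbedding
import HarnessLib

/-!
# Direct limits of manifolds: re-indexing, and smooth embeddings into the limit

Two complements to `Literature.Geometry.Manifold.DirectLimitManifold` (the direct limit `d.Limit`
of a smooth directed system `d` of manifolds along injective local diffeomorphisms; Choquet-Bruhat–
Geroch 1969, proof of Thm. 3, p. 333, the manifold `K̃`):

* `SmoothDirectLimitData.exists_subset_range_incl_of_isCompact` — compact subsets of the limit lie
  in the image of one piece;
* `SmoothDirectLimitData.comapIndex` — **re-indexing** along a monotone map of preorders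
  `φ : J → ι` (pieces `obj (φ j)`); used to present the union of a chain of developments by a
  countable cofinal sub-chain, so that its carrier lands in the universe of the data;
* `SmoothDirectLimitData.isImmersionAtOfComplement_incl_comp`,
  `SmoothDirectLimitData.isSmoothEmbedding_incl_comp` — **`incl i ∘ g` is an immersion / a smooth
  embedding where `g` is**: the atlas of the limit consists of the lifts of ALL charts of the
  maximal atlases of the pieces, so the charts exhibiting `g` as `u ↦ (u, 0)` lift to charts of
  the limit exhibiting `incl i ∘ g` the same way (the device of
  `Literature.Topology.FourManifolds.SmoothGlueData.isImmersionAtOfComplement_inl_comp` for the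
  two-piece gluing). This makes `incl i ∘ ι` a smooth embedding of the data manifold into the
  union of a chain of developments.

## References

* Y. Choquet-Bruhat, R. Geroch, Comm. Math. Phys. 14 (1969) 329–335, proof of Thm. 3, p. 333.
  [ChoquetBruhatGeroch1969CMP]
* A. Kosinski, *Differential Manifolds*, Academic Press 1993, VI.1. [folklore]
-/

open scoped Manifold ContDiff Topology
open Set Function _root_.Topology OpenPartialHomeomorph

noncomputable section

namespace Literature.Geometry.Manifold

namespace SmoothDirectLimitData

universe u v w w'

variable {E : Type v} [NormedAddCommGroup E] [NormedSpace ℝ E] {ι : Type w} [Preorder ι]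

/-! ### Re-indexing along a monotone map -/

section ComapIndex

variable {J : Type w'} [Preorder J]

/-- **Re-indexing** a smooth directed system along a monotone map `φ : J → ι` of preorders: pieces
`obj (φ j)`, transition maps `map (φ j) (φ j')`. [folklore] -/
@[reducible] def comapIndex (d : SmoothDirectLimitData.{u, v, w} E ι) (φ : J → ι) (hφ : Monotone φ) :
    SmoothDirectLimitData.{u, v, w'} E J where
  obj j := d.obj (φ j)
  map j j' h := d.map (φ j) (φ j') (hφ h)
  directedSystem :=
    ⟨fun _ x ↦ DirectedSystem.map_self' d.map x,
      fun _ _ _ h h' x ↦ DirectedSystem.map_map' d.map (hφ h) (hφ h') x⟩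
  injective _ _ h := d.injective _ _ (hφ h)
  isLocalDiffeomorph _ _ h := d.isLocalDiffeomorph _ _ (hφ h)

/-- The pieces of the re-indexed system. [folklore] -/
@[simp] theorem comapIndex_obj (d : SmoothDirectLimitData.{u, v, w} E ι) (φ : J → ι)
    (hφ : Monotone φ) (j : J) : (d.comapIndex φ hφ).obj j = d.obj (φ j) := rfl

/-- The transition maps of the re-indexed system. [folklore] -/
@[simp] theorem comapIndex_map_apply (d : SmoothDirectLimitData.{u, v, w} E ι) (φ : J → ι)
    (hφ : Monotone φ) {j j' : J} (h : j ≤ j') (x : d.obj (φ j)) :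
    (d.comapIndex φ hφ).map j j' h x = d.map (φ j) (φ j') (hφ h) x := rfl

end ComapIndex


/-! ### Compact subsets of the limit -/

section Compact

variable [IsDirectedOrder ι] (d : SmoothDirectLimitData.{u, v, w} E ι)

/-- **Every compact subset of the limit lies in the image of one piece** (the images form a
directed open cover; `Literature.Topology.exists_subset_range_directLimitMk_of_isCompact`).
[folklore] -/
theorem exists_subset_range_incl_of_isCompact [Nonempty ι] {K : Set d.Limit} (hK : IsCompact K) :
    ∃ i, K ⊆ range (d.incl i) :=
  Literature.Topology.exists_subset_range_directLimitMk_of_isCompact d.map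
    (fun i j h ↦ (d.isOpenEmbedding_map i j h).isOpenMap) hK

end Compact

/-! ### Immersions and smooth embeddings into the limit -/

section Immersion

variable [IsDirectedOrder ι] (d : SmoothDirectLimitData.{u, v, w} E ι)
  {F : Type*} [NormedAddCommGroup F] [NormedSpace ℝ F]
  {E_Q H_Q : Type*} [NormedAddCommGroup E_Q] [NormedSpace ℝ E_Q] [TopologicalSpace H_Q]
  {I_Q : ModelWithCorners ℝ E_Q H_Q} {Q : Type*} [TopologicalSpace Q] [ChartedSpace H_Q Q]

/-- **`incl i ∘ g` is an immersion where `g` is.** If `g : Q → obj i` is a `C^∞` immersion at `q`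
with complement `F` (charts `φ`, `χ` in which `g` reads `u ↦ L (u, 0)`), then
`incl i ∘ g : Q → lim obj` is one too, with the lifted chart `chartLift i χ` of the limit (a chart
of the limit because `χ` is in the maximal atlas of the piece). [folklore] -/
theorem isImmersionAtOfComplement_incl_comp (i : ι) {g : Q → d.obj i} {q : Q}
    (hg : Manifold.IsImmersionAtOfComplement F I_Q 𝓘(ℝ, E) ∞ g q) :
    Manifold.IsImmersionAtOfComplement F I_Q 𝓘(ℝ, E) ∞ (d.incl i ∘ g) q := by
  refine Manifold.IsImmersionAtOfComplement.mk_of_charts hg.equiv hg.domChart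
    (d.chartLift i hg.codChart) hg.mem_domChart_source ?_ hg.domChart_mem_maximalAtlas
    (d.chartLift_mem_maximalAtlas hg.codChart_mem_maximalAtlas) ?_ ?_
  · exact ⟨_, hg.mem_codChart_source, rfl⟩
  · intro x hx
    exact ⟨_, hg.source_subset_preimage_source hx, rfl⟩
  · intro u hu
    have h := hg.writtenInCharts hu
    simp only [comp_apply, extend_coe, modelWithCornersSelf_coe, id_eq] at h
    simp only [comp_apply, extend_coe, modelWithCornersSelf_coe, id_eq, chartLift_apply_incl]
    exact h

/-- **`incl i ∘ g` is a smooth embedding where `g` is** (immersion by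
`isImmersionAtOfComplement_incl_comp`, topological embedding as the composite of the embedding `g`
with the open embedding `incl i`). [folklore] -/
theorem isSmoothEmbedding_incl_comp (i : ι) {g : Q → d.obj i}
    (hg : Manifold.IsSmoothEmbedding I_Q 𝓘(ℝ, E) ∞ g) :
    Manifold.IsSmoothEmbedding I_Q 𝓘(ℝ, E) ∞ (d.incl i ∘ g) := by
  obtain ⟨⟨F', _, _, hF⟩, hemb⟩ := hg
  exact ⟨Manifold.IsImmersionOfComplement.isImmersion fun q ↦
    d.isImmersionAtOfComplement_incl_comp i (hF q), (d.isOpenEmbedding_incl i).isEmbedding.comp hemb⟩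

/-- The canonical maps themselves are smooth embeddings. [folklore] -/
theorem isSmoothEmbedding_incl (i : ι) : Manifold.IsSmoothEmbedding 𝓘(ℝ, E) 𝓘(ℝ, E) ∞ (d.incl i) :=
  d.isSmoothEmbedding_incl_comp i Manifold.IsSmoothEmbedding.id

end Immersion

end SmoothDirectLimitData

end Literature.Geometry.Manifold

end
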